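import Summits.NavierStokesRegularity.NavierStokesRegularity.Theorems.RungBlowupCofinal.SolidHarmonicAnsatz
import HarnessLib

/-!
# The precession letter `αJ₃` on solid-harmonic lifts: for a `K₂`-pair `K₂φ = mψ` the generator
# `J₃ = angGen 2` maps the three-lift ansatz of `φ` to `m` times the three-lift ansatz of `ψ` with
# the SAME radial profiles
# (route `AngularGalerkinLadder`, crux K1 `RungBlowupCofinal`; kinematic/linear helper, theorems only)

Cell `ns-blowup`, seat `ns-blowup-circuit` (g11, AGL Lean seat). Helper file for
`stmt-NavierStokesRegularity-19959` serving the line `Cruxes/RungBlowupCofinal/Lines/qlwave.lean`: the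
wave equation of `Qlwave.IsMeanWaveProfile` carries the precession (Coriolis) letter
`α • angGen 2 W y`. On the sectoral pair `φ, ψ = Re, Im (y₀+iy₁)ⁿ` (`K₂φ = nψ`, `K₂ψ = −nφ`,
`SectoralHarmonics.scalarRot_two_re/im_clm_pow`) this file shows that `J₃` acts on the three-profile
class of `SolidHarmonicAnsatz.lean` / `SectoralWaveAnsatz.lean` as the `2 × 2` rotation block
`(U_φ, U_ψ) ↦ (mU_ψ, −mU_φ)` at FIXED radial profiles — so together with
`SolidHarmonicProfileOperator.lean` (`A = −Δ + ½ + ½y·∇`) the whole LINEAR part `A + αJ₃` of the wave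
equation is an explicit radial operator on six profiles. LABEL: KERNEL (linear algebra of the MODEL's
profile operator). Nothing here asserts a Theses declaration; no definition, no named fact. WHAT
THIS IS NOT: not Navier–Stokes evidence; not a profile; nothing about the nonlinear, pressure or
defect letters.

## Content

For smooth `φ, ψ` with `K₂φ = mψ` (`K₂φ = (y ↦ −Dφ(y)(e₂ × y))`):
* `angGen_two_gradient_of_pair` (`J₃∇φ = m∇ψ`, tree `angGen_gradient`), `angGen_two_smulSelf_of_pair`
  (`J₃(φx) = m(ψx)`, `angGen_smulSelf`), `angGen_two_crossSelf_gradient_of_pair` (`J₃(x × ∇φ) =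
  m(x × ∇ψ)`, `angGen_crossSelf`);
* **`angGen_two_threeLift_of_pair`**: `J₃(a(ρ)∇φ + b(ρ)φx + c(ρ)x × ∇φ) = m·(a(ρ)∇ψ + b(ρ)ψx +
  c(ρ)x × ∇ψ)` (radial multipliers commute with `J₃`, tree `angGen_radial_smul`).

[cite: BullardGellman1954] (azimuthal order; here projection-free).
-/

noncomputable section

namespace Summit.NavierStokesRegularity.AngularGalerkinLadderSolidHarmonicPrecession

open Set Function
open scoped ContDiff RealInnerProductSpace
open Literature.Analysis.FluidPDE
open Summit.NavierStokesRegularity.FluidComputer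
open Summit.NavierStokesRegularity.FluidComputer.AngularLadder
open Summit.NavierStokesRegularity.AngularGalerkinLadderToroidalLift
open Summit.NavierStokesRegularity.AngularGalerkinLadderSolidHarmonicLifts

variable {φ ψ : EuclideanSpace ℝ (Fin 3) → ℝ} {a b c : ℝ → ℝ} {m : ℝ}

/-- `∇(c φ) = c ∇φ`. [folklore] -/
private theorem gradient_const_mul' (hφ : Differentiable ℝ φ) (r : ℝ) :
    gradient (fun y => r * φ y) = fun y => r • gradient φ y := by
  funext y
  refine ext_inner_right ℝ fun w => ?_
  rw [inner_gradient_left, real_inner_smul_left, inner_gradient_left, fderiv_const_mul (hφ y) r]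
  simp only [FunLike.coe_smul, Pi.smul_apply, smul_eq_mul]

/-- The gradient field of a smooth function is smooth. [folklore] -/
private theorem contDiff_gradient' (hφ : ContDiff ℝ ∞ φ) : ContDiff ℝ ∞ (gradient φ) := by
  set Lr : (EuclideanSpace ℝ (Fin 3) →L[ℝ] ℝ) →L[ℝ] EuclideanSpace ℝ (Fin 3) :=
    (InnerProductSpace.toDual ℝ (EuclideanSpace ℝ (Fin 3))).symm.toContinuousLinearEquiv.toContinuousLinearMap
    with hLr
  have h1 : gradient φ = fun y => Lr (fderiv ℝ φ y) := rfl
  rw [h1]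
  exact Lr.contDiff.comp (contDiff_infty_iff_fderiv.1 hφ).2

/-- **`J₃∇φ = m∇ψ`** for a `K₂`-pair. [folklore] -/
theorem angGen_two_gradient_of_pair (hφ : ContDiff ℝ ∞ φ) (hψ : ContDiff ℝ ∞ ψ)
    (h1 : ∀ y, -fderiv ℝ φ y (crossCLM (axis 2) y) = m * ψ y) :
    angGen 2 (gradient φ) = fun y => m • gradient ψ y := by
  rw [angGen_gradient hφ 2, show (fun y => -fderiv ℝ φ y (crossCLM (axis 2) y)) = fun y => m * ψ y
    from funext h1, gradient_const_mul' (hψ.differentiable (by simp))]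

/-- **`J₃(φx) = m(ψx)`** for a `K₂`-pair. [folklore] -/
theorem angGen_two_smulSelf_of_pair (hφ : ContDiff ℝ ∞ φ)
    (h1 : ∀ y, -fderiv ℝ φ y (crossCLM (axis 2) y) = m * ψ y) :
    angGen 2 (fun x : EuclideanSpace ℝ (Fin 3) => φ x • x) =
      fun y : EuclideanSpace ℝ (Fin 3) => m • (ψ y • y) := by
  rw [angGen_smulSelf (hφ.differentiable (by simp)) 2]
  funext y
  rw [h1 y, smul_smul]

/-- **`J₃(x × ∇φ) = m(x × ∇ψ)`** for a `K₂`-pair. [folklore] -/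
theorem angGen_two_crossSelf_gradient_of_pair (hφ : ContDiff ℝ ∞ φ) (hψ : ContDiff ℝ ∞ ψ)
    (h1 : ∀ y, -fderiv ℝ φ y (crossCLM (axis 2) y) = m * ψ y) :
    angGen 2 (fun x => cross x (gradient φ x)) = fun y => m • cross y (gradient ψ y) := by
  rw [angGen_crossSelf ((contDiff_gradient' hφ).differentiable (by simp)) 2,
    angGen_two_gradient_of_pair hφ hψ h1]
  funext y
  rw [← crossCLM_apply, ← crossCLM_apply, map_smul]

/-- **THE PRECESSION LETTER ON THE THREE-LIFT ANSATZ**: for a `K₂`-pair `K₂φ = mψ` and smooth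
radial profiles `a, b, c`,
`J₃(a(ρ)∇φ + b(ρ)φx + c(ρ)x × ∇φ)(y) = m·(a(ρ)∇ψ + b(ρ)ψx + c(ρ)x × ∇ψ)(y)`, `ρ = ‖y‖²` — the same
profiles, the partner harmonic. [cite: BullardGellman1954] -/
theorem angGen_two_threeLift_of_pair (ha : ContDiff ℝ ∞ a) (hb : ContDiff ℝ ∞ b) (hc : ContDiff ℝ ∞ c)
    (hφ : ContDiff ℝ ∞ φ) (hψ : ContDiff ℝ ∞ ψ)
    (h1 : ∀ y, -fderiv ℝ φ y (crossCLM (axis 2) y) = m * ψ y) (y : EuclideanSpace ℝ (Fin 3)) :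
    angGen 2 (fun x : EuclideanSpace ℝ (Fin 3) =>
      a (‖x‖ ^ 2) • gradient φ x + b (‖x‖ ^ 2) • (φ x • x) + c (‖x‖ ^ 2) • cross x (gradient φ x)) y =
      m • (a (‖y‖ ^ 2) • gradient ψ y + b (‖y‖ ^ 2) • (ψ y • y) +
        c (‖y‖ ^ 2) • cross y (gradient ψ y)) := by
  have hG : ContDiff ℝ ∞ (gradient φ) := contDiff_gradient' hφ
  have hGd : Differentiable ℝ (gradient φ) := hG.differentiable (by simp)
  have hSd : Differentiable ℝ fun x : EuclideanSpace ℝ (Fin 3) => φ x • x :=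
    (contDiff_smulSelf hφ).differentiable (by simp)
  have hTd : Differentiable ℝ fun x => cross x (gradient φ x) :=
    (contDiff_crossSelf hG).differentiable (by simp)
  have had : Differentiable ℝ a := ha.differentiable (by simp)
  have hbd : Differentiable ℝ b := hb.differentiable (by simp)
  have hcd : Differentiable ℝ c := hc.differentiable (by simp)
  have h1d : Differentiable ℝ fun x : EuclideanSpace ℝ (Fin 3) => a (‖x‖ ^ 2) • gradient φ x :=
    (contDiff_radial_smul ha hG).differentiable (by simp)
  have h2d : Differentiable ℝ fun x : EuclideanSpace ℝ (Fin 3) => b (‖x‖ ^ 2) • (φ x • x) :=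
    (contDiff_radial_smul hb (contDiff_smulSelf hφ)).differentiable (by simp)
  have h3d : Differentiable ℝ fun x : EuclideanSpace ℝ (Fin 3) => c (‖x‖ ^ 2) • cross x (gradient φ x) :=
    (contDiff_radial_smul hc (contDiff_crossSelf hG)).differentiable (by simp)
  have h12d : Differentiable ℝ ((fun x : EuclideanSpace ℝ (Fin 3) => a (‖x‖ ^ 2) • gradient φ x) +
      fun x : EuclideanSpace ℝ (Fin 3) => b (‖x‖ ^ 2) • (φ x • x)) := h1d.add h2d
  have e : (fun x : EuclideanSpace ℝ (Fin 3) => a (‖x‖ ^ 2) • gradient φ x + b (‖x‖ ^ 2) • (φ x • x) +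
      c (‖x‖ ^ 2) • cross x (gradient φ x)) =
      (fun x : EuclideanSpace ℝ (Fin 3) => a (‖x‖ ^ 2) • gradient φ x) +
        (fun x : EuclideanSpace ℝ (Fin 3) => b (‖x‖ ^ 2) • (φ x • x)) +
        fun x : EuclideanSpace ℝ (Fin 3) => c (‖x‖ ^ 2) • cross x (gradient φ x) := rfl
  rw [e, angGen_add h12d h3d 2, angGen_add h1d h2d 2]
  simp only [Pi.add_apply, angGen_radial_smul had hGd 2, angGen_radial_smul hbd hSd 2,
    angGen_radial_smul hcd hTd 2, angGen_two_gradient_of_pair hφ hψ h1,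
    angGen_two_smulSelf_of_pair hφ h1, angGen_two_crossSelf_gradient_of_pair hφ hψ h1,
    smul_comm (a (‖y‖ ^ 2)) m, smul_comm (b (‖y‖ ^ 2)) m, smul_comm (c (‖y‖ ^ 2)) m, smul_add]

end Summit.NavierStokesRegularity.AngularGalerkinLadderSolidHarmonicPrecession

end
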